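import Summits.MatrixMultiplication.MatrixMultiplication.Theorems.ConeTensorApexCones
import HarnessLib

/-!
# ConeTensorApex — part 2 of 3: the fourfold product `⊠_a cone^{(a)}` (`apexProduct`,
`R₄ ≤ R₄(W_n)⁴`) and **`T(K₄)_{(n·n)³}` as its pullback**, whence `R₄(T(K₄)_{(n·n)³}) ≤ R₄(W_n)⁴`
(`tensorRankD_tetra_cube_le`). See `ConeTensorApexCones` for the overview and sources
(Christandl–Vrana–Zuiddam arXiv:1609.07476, Prop. 1.1.16 and Prop. 2.1.7: the symmetrisation
`τ(T(G)) ≤ log_N R(T_f(G))` for edge-transitive `G`, here `G = K₄`, `f = (n², n², n², n, n, n)`, via the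
apex sub-orbit). No `sorry`, no new axiom, no instance, no notation, no `Prop`-valued definition.
-/

noncomputable section

set_option linter.dupNamespace false

open scoped BigOperators
open Filter Asymptotics Module
open Literature.Computability.AlgebraicComplexity
open Summit.MatrixMultiplication.MatrixMultiplication.Theorems.TetrahedronTensor

namespace Summit.MatrixMultiplication.MatrixMultiplication.Theorems.ConeTensor
/-! ## The product of the four apex cones and its rank -/

section Product

variable (F : Type*) [Field F]

/-- Component `a` of a leg index of the fourfold product format. -/
def κ {M : ℕ} (x : Fin (M ^ 4)) (a : Fin 4) : Fin M :=
  finFunctionFinEquiv.symm x a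

/-- **The product of the four apex cones** on disjoint coordinates,
`(⊠_a cone^{(a)})(i) = ∏_a cone^{(a)}(κ_a ∘ i)`. (CVZ19, Prop. 1.1.16 (proof)). -/
def apexProduct (n : ℕ) : (Fin 4 → Fin (((n * n) ^ 3) ^ 4)) → F := fun i =>
  cone F n (fun v => κ (i v) 0) * cone₁ F n (fun v => κ (i v) 1) *
    cone₂ F n (fun v => κ (i v) 2) * cone₃ F n (fun v => κ (i v) 3)

variable {F}

/-- Product legs of the fourfold product from four rank-one decompositions. -/
def productLeg {n s M : ℕ} (u₀ u₁ u₂ u₃ : Fin s → Fin 4 → Fin ((n * n) ^ 3) → F)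
    (pr : Fin M → Fin 4 → Fin ((n * n) ^ 3)) (l : Fin 4 → Fin s) : Fin 4 → Fin M → F :=
  fun v x => u₀ (l 0) v (pr x 0) * u₁ (l 1) v (pr x 1) * u₂ (l 2) v (pr x 2) * u₃ (l 3) v (pr x 3)

/-- The fourfold product is the sum of the `s⁴` product legs. [cite: ChristandlVranaZuiddam2016, Prop. 1.1.16 (proof)] -/
theorem apexProduct_eq_sum {n s : ℕ} {u₀ u₁ u₂ u₃ : Fin s → Fin 4 → Fin ((n * n) ^ 3) → F}
    (h₀ : ∑ k, rankOneTensor (u₀ k) = cone F n) (h₁ : ∑ k, rankOneTensor (u₁ k) = cone₁ F n)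
    (h₂ : ∑ k, rankOneTensor (u₂ k) = cone₂ F n) (h₃ : ∑ k, rankOneTensor (u₃ k) = cone₃ F n) :
    ∑ l : Fin 4 → Fin s, rankOneTensor (productLeg u₀ u₁ u₂ u₃ κ l) = apexProduct F n := by
  classical
  funext i
  let T : Fin 4 → Fin s → F := ![fun k => rankOneTensor (u₀ k) (fun v => κ (i v) 0),
    fun k => rankOneTensor (u₁ k) (fun v => κ (i v) 1),
    fun k => rankOneTensor (u₂ k) (fun v => κ (i v) 2),
    fun k => rankOneTensor (u₃ k) (fun v => κ (i v) 3)]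
  calc (∑ l : Fin 4 → Fin s, rankOneTensor (productLeg u₀ u₁ u₂ u₃ κ l)) i
      = ∑ l : Fin 4 → Fin s, ∏ a, T a (l a) := by
        rw [Finset.sum_apply]
        refine Finset.sum_congr rfl fun l _ => ?_
        rw [rankOneTensor_apply, Fin.prod_univ_four, Fin.prod_univ_four]
        simp only [productLeg, T, Matrix.cons_val_zero, Matrix.cons_val_one, Matrix.cons_val_two,
          Matrix.cons_val_three, Matrix.head_cons, Matrix.tail_cons, rankOneTensor_apply,
          Fin.prod_univ_four]
        ring
    _ = ∏ a, ∑ k, T a k := (Fintype.prod_sum T).symm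
    _ = apexProduct F n i := by
        rw [Fin.prod_univ_four]
        simp only [T, Matrix.cons_val_zero, Matrix.cons_val_one, Matrix.cons_val_two,
          Matrix.cons_val_three, Matrix.head_cons, Matrix.tail_cons]
        rw [← Finset.sum_apply, ← Finset.sum_apply, ← Finset.sum_apply, ← Finset.sum_apply,
          h₀, h₁, h₂, h₃]
        rfl

/-- **`R₄(⊠_a cone^{(a)}) ≤ R₄(W_n)⁴`**. [cite: ChristandlVranaZuiddam2016, Prop. 1.1.16] -/
theorem tensorRankD_apexProduct_le (n : ℕ) :
    tensorRankD (apexProduct F n) ≤ tensorRankD (cone F n) ^ 4 := by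
  classical
  obtain ⟨u₀, u₁, u₂, u₃, h₀, h₁, h₂, h₃⟩ := exists_rankOne_decompositions_apex (F := F) n
  have hsum := apexProduct_eq_sum h₀ h₁ h₂ h₃
  have hcard : Fintype.card (Fin 4 → Fin (tensorRankD (cone F n))) = tensorRankD (cone F n) ^ 4 := by
    simp
  rw [← hcard]
  let e := Fintype.equivFin (Fin 4 → Fin (tensorRankD (cone F n)))
  refine tensorRankD_le_of_eq_sum (fun k => productLeg u₀ u₁ u₂ u₃ κ (e.symm k)) ?_
  rw [← hsum]
  exact Fintype.sum_equiv e.symm _ _ (fun _ => rfl)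

/-- The fourfold product is decomposable (needed for pullbacks). [folklore] -/
theorem apexProduct_decomposable (n : ℕ) :
    ∃ s : ℕ, ∃ g : Fin s → ((Fin 4 → Fin (((n * n) ^ 3) ^ 4)) → F),
      (∀ k, g k ∈ rankOneTensors F (((n * n) ^ 3) ^ 4) 4) ∧ ∑ k, g k = apexProduct F n := by
  classical
  obtain ⟨u₀, u₁, u₂, u₃, h₀, h₁, h₂, h₃⟩ := exists_rankOne_decompositions_apex (F := F) n
  have hsum := apexProduct_eq_sum h₀ h₁ h₂ h₃
  let e := Fintype.equivFin (Fin 4 → Fin (tensorRankD (cone F n)))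
  refine ⟨_, fun k => rankOneTensor (productLeg u₀ u₁ u₂ u₃ κ (e.symm k)),
    fun k => rankOneTensor_mem _, ?_⟩
  rw [← hsum]
  exact Fintype.sum_equiv e.symm _ _ (fun _ => rfl)

end Product

/-! ## `T(K₄)_{(n·n)³}` is a pullback of the fourfold product -/

section Pullback

variable {n : ℕ}

/-- Duplicate the first half of the third pair of a label: `y ↦ (P₁ y 2, P₁ y 2)`. -/
def du₁ (y : Fin ((n * n) ^ 3)) : Fin (n * n) := finProdFinEquiv (P₁ y 2, P₁ y 2)

/-- Duplicate the second half of the third pair of a label: `y ↦ (P₂ y 2, P₂ y 2)`. -/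
def du₂ (y : Fin ((n * n) ^ 3)) : Fin (n * n) := finProdFinEquiv (P₂ y 2, P₂ y 2)

/-- Halves of `du₁` (first). [folklore] -/
theorem fst_du₁ (y : Fin ((n * n) ^ 3)) : (finProdFinEquiv.symm (du₁ y)).1 = P₁ y 2 := by simp [du₁]
/-- Halves of `du₁` (second). [folklore] -/
theorem snd_du₁ (y : Fin ((n * n) ^ 3)) : (finProdFinEquiv.symm (du₁ y)).2 = P₁ y 2 := by simp [du₁]
/-- Halves of `du₂` (first). [folklore] -/
theorem fst_du₂ (y : Fin ((n * n) ^ 3)) : (finProdFinEquiv.symm (du₂ y)).1 = P₂ y 2 := by simp [du₂]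
/-- Halves of `du₂` (second). [folklore] -/
theorem snd_du₂ (y : Fin ((n * n) ^ 3)) : (finProdFinEquiv.symm (du₂ y)).2 = P₂ y 2 := by simp [du₂]
/-- `P₁ y 0`, unfolded. [folklore] -/
theorem fst_slot₀ (y : Fin ((n * n) ^ 3)) :
    (finProdFinEquiv.symm (finFunctionFinEquiv.symm y 0)).1 = P₁ y 0 := rfl
/-- `P₂ y 0`, unfolded. [folklore] -/
theorem snd_slot₀ (y : Fin ((n * n) ^ 3)) :
    (finProdFinEquiv.symm (finFunctionFinEquiv.symm y 0)).2 = P₂ y 0 := rfl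
/-- `P₁ y 1`, unfolded. [folklore] -/
theorem fst_slot₁ (y : Fin ((n * n) ^ 3)) :
    (finProdFinEquiv.symm (finFunctionFinEquiv.symm y 1)).1 = P₁ y 1 := rfl
/-- `P₂ y 1`, unfolded. [folklore] -/
theorem snd_slot₁ (y : Fin ((n * n) ^ 3)) :
    (finProdFinEquiv.symm (finFunctionFinEquiv.symm y 1)).2 = P₂ y 1 := rfl

/-- The leg index of apex factor `a` at vertex `v`, read off a leg index `z` of `T(K₄)_{(n·n)³}`
(labels `y_s = z_s ∈ (n·n)³`, six halves each): on the edge `e = {v, w}` the cone with apex `min e`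
gets the pair `y 0`, apex `max e` the pair `y 1`, the two other apexes the duplicated halves of
`y 2`. (CVZ19, Prop. 1.1.16 (proof)). -/
def apexLegs : Fin 4 → Fin 4 → Fin (((n * n) ^ 3) ^ 3) → Fin ((n * n) ^ 3) :=
  ![![fun z => enc (finFunctionFinEquiv.symm (finFunctionFinEquiv.symm z 0) 0)
        (finFunctionFinEquiv.symm (finFunctionFinEquiv.symm z 1) 0)
        (finFunctionFinEquiv.symm (finFunctionFinEquiv.symm z 2) 0),
      fun z => enc (finFunctionFinEquiv.symm (finFunctionFinEquiv.symm z 0) 1)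
        (du₁ (finFunctionFinEquiv.symm z 1)) (du₁ (finFunctionFinEquiv.symm z 2)),
      fun z => enc (du₁ (finFunctionFinEquiv.symm z 0))
        (finFunctionFinEquiv.symm (finFunctionFinEquiv.symm z 1) 1) (du₂ (finFunctionFinEquiv.symm z 2)),
      fun z => enc (du₂ (finFunctionFinEquiv.symm z 0)) (du₂ (finFunctionFinEquiv.symm z 1))
        (finFunctionFinEquiv.symm (finFunctionFinEquiv.symm z 2) 1)],
    ![fun z => enc (finFunctionFinEquiv.symm (finFunctionFinEquiv.symm z 0) 0)
        (du₁ (finFunctionFinEquiv.symm z 1)) (du₁ (finFunctionFinEquiv.symm z 2)),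
      fun z => enc (finFunctionFinEquiv.symm (finFunctionFinEquiv.symm z 0) 1)
        (finFunctionFinEquiv.symm (finFunctionFinEquiv.symm z 1) 0)
        (finFunctionFinEquiv.symm (finFunctionFinEquiv.symm z 2) 0),
      fun z => enc (du₁ (finFunctionFinEquiv.symm z 0))
        (finFunctionFinEquiv.symm (finFunctionFinEquiv.symm z 1) 1) (du₂ (finFunctionFinEquiv.symm z 2)),
      fun z => enc (du₂ (finFunctionFinEquiv.symm z 0)) (du₂ (finFunctionFinEquiv.symm z 1))
        (finFunctionFinEquiv.symm (finFunctionFinEquiv.symm z 2) 1)],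
    ![fun z => enc (finFunctionFinEquiv.symm (finFunctionFinEquiv.symm z 0) 0)
        (du₁ (finFunctionFinEquiv.symm z 1)) (du₁ (finFunctionFinEquiv.symm z 2)),
      fun z => enc (du₁ (finFunctionFinEquiv.symm z 0))
        (finFunctionFinEquiv.symm (finFunctionFinEquiv.symm z 1) 0) (du₂ (finFunctionFinEquiv.symm z 2)),
      fun z => enc (finFunctionFinEquiv.symm (finFunctionFinEquiv.symm z 0) 1)
        (finFunctionFinEquiv.symm (finFunctionFinEquiv.symm z 1) 1)
        (finFunctionFinEquiv.symm (finFunctionFinEquiv.symm z 2) 0),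
      fun z => enc (du₂ (finFunctionFinEquiv.symm z 0)) (du₂ (finFunctionFinEquiv.symm z 1))
        (finFunctionFinEquiv.symm (finFunctionFinEquiv.symm z 2) 1)],
    ![fun z => enc (finFunctionFinEquiv.symm (finFunctionFinEquiv.symm z 0) 0)
        (du₁ (finFunctionFinEquiv.symm z 1)) (du₁ (finFunctionFinEquiv.symm z 2)),
      fun z => enc (du₁ (finFunctionFinEquiv.symm z 0))
        (finFunctionFinEquiv.symm (finFunctionFinEquiv.symm z 1) 0) (du₂ (finFunctionFinEquiv.symm z 2)),
      fun z => enc (du₂ (finFunctionFinEquiv.symm z 0)) (du₂ (finFunctionFinEquiv.symm z 1))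
        (finFunctionFinEquiv.symm (finFunctionFinEquiv.symm z 2) 0),
      fun z => enc (finFunctionFinEquiv.symm (finFunctionFinEquiv.symm z 0) 1)
        (finFunctionFinEquiv.symm (finFunctionFinEquiv.symm z 1) 1)
        (finFunctionFinEquiv.symm (finFunctionFinEquiv.symm z 2) 1)]]

/-- The pullback maps `Ψ_v : (n·n)⁹ → ((n·n)³)⁴`, one leg index per apex factor. -/
def Ψ (v : Fin 4) (z : Fin (((n * n) ^ 3) ^ 3)) : Fin (((n * n) ^ 3) ^ 4) :=
  finFunctionFinEquiv (fun a => apexLegs v a z)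

/-- Components of the pullback maps `Ψ`. [folklore] -/
theorem κ_Ψ (v a : Fin 4) (z : Fin (((n * n) ^ 3) ^ 3)) : κ (Ψ v z) a = apexLegs v a z := by
  simp [κ, Ψ]

/-- A label of `T(K₄)_{(n·n)³}` is determined by its six halves. -/
theorem label_eq_iff (y y' : Fin ((n * n) ^ 3)) :
    y = y' ↔ (P₁ y 0 = P₁ y' 0 ∧ P₂ y 0 = P₂ y' 0) ∧ (P₁ y 1 = P₁ y' 1 ∧ P₂ y 1 = P₂ y' 1) ∧
      (P₁ y 2 = P₁ y' 2 ∧ P₂ y 2 = P₂ y' 2) := by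
  constructor
  · rintro rfl
    simp
  · rintro ⟨⟨h₁, h₂⟩, ⟨h₃, h₄⟩, ⟨h₅, h₆⟩⟩
    apply finFunctionFinEquiv.symm.injective
    funext c
    apply finProdFinEquiv.symm.injective
    fin_cases c
    · exact Prod.ext h₁ h₂
    · exact Prod.ext h₃ h₄
    · exact Prod.ext h₅ h₆

variable {F : Type*} [Field F]

/-- **`T(K₄)_{(n·n)³}` is the pullback of `⊠_a cone^{(a)}` along `Ψ`.**
[cite: ChristandlVranaZuiddam2016, Prop. 1.1.16 (proof)] -/
theorem tetra_cube_eq_pullback (n : ℕ) :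
    tetra F ((n * n) ^ 3) = fun i => apexProduct F n (fun v => Ψ v (i v)) := by
  funext i
  simp only [apexProduct, κ_Ψ, tetra, cone, cone₁, cone₂, cone₃, matMulTensor, ite_one_zero_mul_ite]
  refine if_congr ?_ rfl rfl
  simp only [consistent_iff, label_eq_iff, apexLegs, Matrix.cons_val_zero, Matrix.cons_val_one,
    Matrix.cons_val_two, Matrix.cons_val_three, Matrix.head_cons, Matrix.tail_cons,
    P₁_enc₀, P₁_enc₁, P₁_enc₂, P₂_enc₀, P₂_enc₁, P₂_enc₂, fst_du₁, snd_du₂,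
    fst_slot₀, snd_slot₀, fst_slot₁, snd_slot₁]
  tauto

/-- **`R₄(T(K₄)_{(n·n)³}) ≤ R₄(W_n)⁴`**. [cite: ChristandlVranaZuiddam2016, Prop. 1.1.16] -/
theorem tensorRankD_tetra_cube_le (n : ℕ) :
    tensorRankD (tetra F ((n * n) ^ 3)) ≤ tensorRankD (cone F n) ^ 4 := by
  rw [tetra_cube_eq_pullback (F := F) n]
  exact (tensorRankD_pullback_le (apexProduct F n) Ψ (apexProduct_decomposable n)).trans
    (tensorRankD_apexProduct_le n)

end Pullback

end Summit.MatrixMultiplication.MatrixMultiplication.Theorems.ConeTensor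

end
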